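import Mathlib
import Literature.Combinatorics.Additive.TripleProductProperty
import Summits.MatrixMultiplication.MatrixMultiplication.Theorems.HyperoctahedralThreshold.Negative.HostedTPPSATComplete

/-!
# Transfer `UNSAT ⇒ volume ≤ V` for hosted TPP triples

Pair packing inside the hosts from the TPP (`HostData.card_mul_card_le_pairCount`, Cohn–Umans
2003, proof of Lemma 3.1: `(x, y) ↦ x⁻¹y` is injective on `S × T`) and the transfer theorem
`HostData.volume_le_of_unsat`: if `certCNF D (pairBounds D) V` is unsatisfiable (an imported LRAT
certificate, `Literature.Computability.Complexity.LRATImport`), every TPP triple hosted by `D`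
and containing the identities has volume `≤ V`.

References: H. Cohn, C. Umans, FOCS 2003, Def. 2.1, Lemma 3.1; C. Sinz, CP 2005, §2.
-/

namespace Summit.MatrixMultiplication.MatrixMultiplication.Theorems.HyperoctahedralThreshold.Negative

set_option linter.dupNamespace false

open Literature.Computability.Complexity Literature.Combinatorics.Additive

namespace HostData

variable {G : Type*} [Group G] [DecidableEq G] {N : ℕ} (D : HostData G N)

/-! ## Pair packing and the transfer theorem -/

/-- **Pair packing inside the hosts** (Cohn–Umans 2003, proof of Lemma 3.1): for a TPP triple
with `X i, X j` hosted and the third set nonempty, `|X i| · |X j| ≤ pairCount i j`, because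
`(x, y) ↦ x⁻¹ y` is injective on `X i × X j`. [cite: CohnUmans2003, Lemma 3.1] -/
theorem card_mul_card_le_pairCount {S T U : Finset G} (h : TripleProductProperty S T U)
    (hU : U.Nonempty) {i j : Fin 3} (hS : ∀ x ∈ S, ∃ a, D.E i a = x) (hT : ∀ y ∈ T, ∃ b, D.E j b = y) :
    S.card * T.card ≤ D.pairCount i j := by
  classical
  have hinj : Set.InjOn (fun st : G × G => st.1⁻¹ * st.2) (↑(S ×ˢ T) : Set (G × G)) := by
    rintro ⟨s, t⟩ hst ⟨s', t'⟩ hst' heq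
    simp only [Finset.coe_product, Set.mem_prod, Finset.mem_coe] at hst hst'
    simp only at heq
    obtain ⟨u, hu⟩ := hU
    -- s⁻¹ t = s'⁻¹ t'  ⇒  s' s⁻¹ (t t'⁻¹) (u u⁻¹) = 1
    have key : s' * s⁻¹ * (t * t'⁻¹) * (u * u⁻¹) = 1 := by
      have : t * t'⁻¹ = s * s'⁻¹ := by
        calc t * t'⁻¹ = s * (s⁻¹ * t) * t'⁻¹ := by group
          _ = s * (s'⁻¹ * t') * t'⁻¹ := by rw [heq]
          _ = s * s'⁻¹ := by group
      rw [this]; group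
    obtain ⟨h1, h2, -⟩ := h s' hst'.1 s hst.1 t hst.2 t' hst'.2 u hu u hu key
    exact Prod.ext h1.symm h2
  calc S.card * T.card = (S ×ˢ T).card := (Finset.card_product S T).symm
    _ = ((S ×ˢ T).image fun st : G × G => st.1⁻¹ * st.2).card := (Finset.card_image_of_injOn hinj).symm
    _ ≤ _ := Finset.card_le_card ?_
  intro z hz
  simp only [Finset.mem_image, Finset.mem_product] at hz
  obtain ⟨⟨s, t⟩, ⟨hs, ht⟩, rfl⟩ := hz
  obtain ⟨a, ha⟩ := hS s hs
  obtain ⟨b, hb⟩ := hT t ht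
  exact Finset.mem_image₂.2 ⟨s, Finset.mem_image.2 ⟨a, Finset.mem_univ _, ha⟩, t,
    Finset.mem_image.2 ⟨b, Finset.mem_univ _, hb⟩, rfl⟩

omit [DecidableEq G] in
/-- Cyclic rotation of the TPP (conjugation). [folklore] -/
theorem tpp_rotate {S T U : Finset G} (h : TripleProductProperty S T U) :
    TripleProductProperty T U S := by
  intro t ht t' ht' u hu u' hu' s hs s' hs' heq
  have heq' : s * s'⁻¹ * (t * t'⁻¹) * (u * u'⁻¹) = 1 :=
    calc s * s'⁻¹ * (t * t'⁻¹) * (u * u'⁻¹)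
        = s * s'⁻¹ * (t * t'⁻¹ * (u * u'⁻¹) * (s * s'⁻¹)) * (s * s'⁻¹)⁻¹ := by group
      _ = 1 := by rw [heq]; group
  obtain ⟨hs1, ht1, hu1⟩ := h s hs s' hs' t ht t' ht' u hu u' hu' heq'
  exact ⟨ht1, hu1, hs1⟩

/-- **From UNSAT to the volume bound.**  If `certCNF D (pairBounds D) V` is unsatisfiable, the
enumerations are injective with `E i (one i) = 1`, and host `i` is closed under `x y⁻¹`, then every
TPP triple `X i ⊆ host i` with `1 ∈ X i` has `|X 0| |X 1| |X 2| ≤ V`. [cite: Sinz2005, §2] -/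
theorem volume_le_of_unsat (hinj : ∀ i, Function.Injective (D.E i))
    (hone : ∀ i, D.E i (D.one i) = 1) (hcl : ∀ i a b, ∃ c, D.E i c = D.E i a * (D.E i b)⁻¹)
    {V : ℕ} (hunsat : ¬ (D.certCNF D.pairBounds V).Satisfiable)
    (X : Fin 3 → Finset G) (hX : ∀ i, ∀ x ∈ X i, ∃ a, D.E i a = x) (hX1 : ∀ i, (1 : G) ∈ X i)
    (htpp : TripleProductProperty (X 0) (X 1) (X 2)) :
    (X 0).card * (X 1).card * (X 2).card ≤ V := by
  classical
  by_contra hlt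
  push Not at hlt
  apply hunsat
  -- index sets
  let I : Fin 3 → Finset (Fin N) := fun i => Finset.univ.filter fun a => D.E i a ∈ X i
  have hIX : ∀ i, (I i).image (D.E i) = X i := by
    intro i; ext x
    simp only [Finset.mem_image, Finset.mem_filter, Finset.mem_univ, true_and, I]
    constructor
    · rintro ⟨a, ha, rfl⟩; exact ha
    · intro hx; obtain ⟨a, rfl⟩ := hX i x hx; exact ⟨a, hx, rfl⟩
  have hcard : ∀ i, (I i).card = (X i).card := fun i => by
    rw [← hIX i, Finset.card_image_of_injective _ (hinj i)]
  have hI1 : ∀ i, D.one i ∈ I i := fun i => by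
    simp only [Finset.mem_filter, Finset.mem_univ, true_and, I, hone]; exact hX1 i
  refine D.certCNF_satisfiable_of_triple hinj hone (I := I) hI1 ?_ ?_ ?_
  · -- IndexTPP
    intro t ht ⟨h0, h1, h2⟩
    obtain ⟨hprod, hne⟩ := D.mem_bad ht
    simp only [Qidx, Finset.mem_image₂] at h0 h1 h2
    obtain ⟨a, ha, a', ha', hq0⟩ := h0
    obtain ⟨b, hb, b', hb', hq1⟩ := h1
    obtain ⟨c, hc, c', hc', hq2⟩ := h2
    simp only [Finset.mem_filter, Finset.mem_univ, true_and, I] at ha ha' hb hb' hc hc'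
    have e0 := D.E_q hcl 0 a a'; have e1 := D.E_q hcl 1 b b'; have e2 := D.E_q hcl 2 c c'
    rw [hq0] at e0; rw [hq1] at e1; rw [hq2] at e2
    have key : D.E 0 a * (D.E 0 a')⁻¹ * (D.E 1 b * (D.E 1 b')⁻¹) * (D.E 2 c * (D.E 2 c')⁻¹) = 1 := by
      rw [← e0, ← e1, ← e2]; exact hprod
    obtain ⟨r0, r1, r2⟩ := htpp _ ha _ ha' _ hb _ hb' _ hc _ hc' key
    apply hne
    refine ⟨hinj 0 ?_, hinj 1 ?_, hinj 2 ?_⟩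
    · rw [e0, r0, mul_inv_cancel, hone]
    · rw [e1, r1, mul_inv_cancel, hone]
    · rw [e2, r2, mul_inv_cancel, hone]
  · -- pair bounds
    intro ij hij
    simp only [pairs, List.mem_cons, List.not_mem_nil, or_false] at hij
    have hne : ∀ i, (X i).Nonempty := fun i => ⟨1, hX1 i⟩
    rcases hij with rfl | rfl | rfl <;> simp only [pairBounds, hcard]
    · exact D.card_mul_card_le_pairCount htpp (hne 2) (hX 0) (hX 1)
    · exact D.card_mul_card_le_pairCount (tpp_rotate htpp) (hne 0) (hX 1) (hX 2)
    · exact D.card_mul_card_le_pairCount (tpp_rotate (tpp_rotate htpp)) (hne 1) (hX 2) (hX 0)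
  · simpa only [hcard] using hlt


/-! ## Hosted triples in three centralisers: removing the normalisation `1 ∈ X i` -/

omit [DecidableEq G] in
/-- The TPP is invariant under right translation of each set (`(xa)(x'a)⁻¹ = x x'⁻¹`).
[folklore] -/
theorem tpp_image_mul_right [DecidableEq G] {S T U : Finset G} (h : TripleProductProperty S T U)
    (a b c : G) :
    TripleProductProperty (S.image (· * a)) (T.image (· * b)) (U.image (· * c)) := by
  intro s hs s' hs' t ht t' ht' u hu u' hu' heq
  simp only [Finset.mem_image] at hs hs' ht ht' hu hu'
  obtain ⟨s, hs, rfl⟩ := hs; obtain ⟨s', hs', rfl⟩ := hs'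
  obtain ⟨t, ht, rfl⟩ := ht; obtain ⟨t', ht', rfl⟩ := ht'
  obtain ⟨u, hu, rfl⟩ := hu; obtain ⟨u', hu', rfl⟩ := hu'
  have e1 : s * a * (s' * a)⁻¹ = s * s'⁻¹ := by group
  have e2 : t * b * (t' * b)⁻¹ = t * t'⁻¹ := by group
  have e3 : u * c * (u' * c)⁻¹ = u * u'⁻¹ := by group
  rw [e1, e2, e3] at heq
  obtain ⟨r1, r2, r3⟩ := h s hs s' hs' t ht t' ht' u hu u' hu' heq
  exact ⟨by rw [r1], by rw [r2], by rw [r3]⟩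

/-- **Volume bound for TPP triples inside three centralisers, from an UNSAT certificate.**
If host `i` of `D` enumerates exactly the centraliser of `μ i` (`hhost`), injectively, with the
identity at `one i`, and `certCNF D (pairBounds D) V` is unsatisfiable, then every TPP triple
`X i ⊆ C(μ i)` has `|X 0| |X 1| |X 2| ≤ V` (empty sets allowed; nonempty ones are right-translated
to contain `1`, which stays inside the centraliser). [cite: CohnUmans2003, Def. 2.1] -/
theorem volume_le_of_unsat_centralizer (μ : Fin 3 → G)
    (hhost : ∀ i σ, σ * μ i = μ i * σ ↔ ∃ a, D.E i a = σ)
    (hinj : ∀ i, Function.Injective (D.E i)) (hone : ∀ i, D.E i (D.one i) = 1)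
    {V : ℕ} (hunsat : ¬ (D.certCNF D.pairBounds V).Satisfiable)
    (X : Fin 3 → Finset G) (hX : ∀ i, ∀ σ ∈ X i, σ * μ i = μ i * σ)
    (htpp : TripleProductProperty (X 0) (X 1) (X 2)) :
    (X 0).card * (X 1).card * (X 2).card ≤ V := by
  classical
  by_cases hne : ∀ i, (X i).Nonempty
  swap
  · push Not at hne
    obtain ⟨i, hi⟩ := hne
    have h0 : (X i).card = 0 := Finset.card_eq_zero.2 hi
    have hprod : (X 0).card * (X 1).card * (X 2).card = ∏ j : Fin 3, (X j).card :=
      (Fin.prod_univ_three (fun j => (X j).card)).symm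
    rw [hprod, Finset.prod_eq_zero (Finset.mem_univ i) h0]
    exact Nat.zero_le _
  choose s hs using hne
  -- translated sets
  let Y : Fin 3 → Finset G := fun i => (X i).image (· * (s i)⁻¹)
  have hcomm : ∀ i (x y : G), x * μ i = μ i * x → y * μ i = μ i * y → x * y⁻¹ * μ i = μ i * (x * y⁻¹) := by
    intro i x y hx hy
    have hy' : y⁻¹ * μ i = μ i * y⁻¹ := by
      calc y⁻¹ * μ i = y⁻¹ * (μ i * y) * y⁻¹ := by group
        _ = y⁻¹ * (y * μ i) * y⁻¹ := by rw [hy]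
        _ = μ i * y⁻¹ := by group
    calc x * y⁻¹ * μ i = x * (y⁻¹ * μ i) := by group
      _ = x * (μ i * y⁻¹) := by rw [hy']
      _ = (x * μ i) * y⁻¹ := by group
      _ = (μ i * x) * y⁻¹ := by rw [hx]
      _ = μ i * (x * y⁻¹) := by group
  have hY : ∀ i, ∀ y ∈ Y i, ∃ a, D.E i a = y := by
    intro i y hy
    simp only [Finset.mem_image, Y] at hy
    obtain ⟨x, hx, rfl⟩ := hy
    exact (hhost i _).1 (hcomm i x (s i) (hX i x hx) (hX i _ (hs i)))
  have hY1 : ∀ i, (1 : G) ∈ Y i := fun i =>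
    Finset.mem_image.2 ⟨s i, hs i, mul_inv_cancel (s i)⟩
  have hcard : ∀ i, (Y i).card = (X i).card := fun i =>
    Finset.card_image_of_injective _ (mul_left_injective ((s i)⁻¹))
  have hcl : ∀ i a b, ∃ c, D.E i c = D.E i a * (D.E i b)⁻¹ := fun i a b =>
    (hhost i _).1 (hcomm i _ _ ((hhost i _).2 ⟨a, rfl⟩) ((hhost i _).2 ⟨b, rfl⟩))
  have hYtpp : TripleProductProperty (Y 0) (Y 1) (Y 2) := tpp_image_mul_right htpp _ _ _
  have := D.volume_le_of_unsat hinj hone hcl hunsat Y hY hY1 hYtpp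
  simpa only [hcard] using this

end HostData

/-! ## Symmetries of hosted volume bounds (colour permutation, conjugation) -/

section symm
variable {G : Type*} [Group G]

/-- Reversal of the TPP: invert the product (`Q(X)` is symmetric). [folklore] -/
theorem tpp_reverse {S T U : Finset G} (h : TripleProductProperty S T U) :
    TripleProductProperty U T S := by
  intro u hu u' hu' t ht t' ht' s hs s' hs' heq
  -- invert: (u u'⁻¹ (t t'⁻¹) (s s'⁻¹))⁻¹ = s' s⁻¹ (t' t⁻¹) (u' u⁻¹) = 1
  have heq' : s' * s⁻¹ * (t' * t⁻¹) * (u' * u⁻¹) = 1 :=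
    calc s' * s⁻¹ * (t' * t⁻¹) * (u' * u⁻¹) = (u * u'⁻¹ * (t * t'⁻¹) * (s * s'⁻¹))⁻¹ := by group
      _ = 1 := by rw [heq, inv_one]
  obtain ⟨h1, h2, h3⟩ := h s' hs' s hs t' ht' t ht u' hu' u hu heq'
  exact ⟨h3.symm, h2.symm, h1.symm⟩

/-- The TPP of `(X 0, X 1, X 2)` is invariant under every permutation of the three sets. [folklore] -/
theorem tpp_perm3 [DecidableEq G] {X : Fin 3 → Finset G} (h : TripleProductProperty (X 0) (X 1) (X 2))
    (π : Equiv.Perm (Fin 3)) : TripleProductProperty (X (π 0)) (X (π 1)) (X (π 2)) := by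
  have hπ : π = 1 ∨ π = Equiv.swap 0 1 ∨ π = Equiv.swap 0 2 ∨ π = Equiv.swap 1 2 ∨
      π = Equiv.swap 0 1 * Equiv.swap 1 2 ∨ π = Equiv.swap 1 2 * Equiv.swap 0 1 := by
    revert π; decide
  have r1 := HostData.tpp_rotate h            -- (1,2,0)
  have r2 := HostData.tpp_rotate r1           -- (2,0,1)
  have v0 := tpp_reverse h            -- (2,1,0)
  have v1 := tpp_reverse r1           -- (0,2,1)
  have v2 := tpp_reverse r2           -- (1,0,2)
  rcases hπ with rfl | rfl | rfl | rfl | rfl | rfl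
  · simpa using h
  · simpa [Equiv.swap_apply_of_ne_of_ne] using v2
  · simpa [Equiv.swap_apply_of_ne_of_ne] using v0
  · simpa [Equiv.swap_apply_of_ne_of_ne] using v1
  · simp [Equiv.Perm.mul_apply, Equiv.swap_apply_of_ne_of_ne]
    exact r1
  · simp [Equiv.Perm.mul_apply, Equiv.swap_apply_of_ne_of_ne]
    exact r2

/-- **Colour-permutation invariance of a hosted volume bound.** [folklore] -/
theorem hosted_bound_perm [DecidableEq G] {μ : Fin 3 → G} {V : ℕ}
    (hb : ∀ X : Fin 3 → Finset G, (∀ i, ∀ σ ∈ X i, σ * μ i = μ i * σ) →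
      TripleProductProperty (X 0) (X 1) (X 2) → (X 0).card * (X 1).card * (X 2).card ≤ V)
    (π : Equiv.Perm (Fin 3)) :
    ∀ X : Fin 3 → Finset G, (∀ i, ∀ σ ∈ X i, σ * μ (π i) = μ (π i) * σ) →
      TripleProductProperty (X 0) (X 1) (X 2) → (X 0).card * (X 1).card * (X 2).card ≤ V := by
  intro X hX htpp
  let Y : Fin 3 → Finset G := fun j => X (π.symm j)
  have hY : ∀ j, ∀ σ ∈ Y j, σ * μ j = μ j * σ := fun j σ hσ => by
    have := hX (π.symm j) σ hσ
    simpa using this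
  have hYtpp : TripleProductProperty (Y 0) (Y 1) (Y 2) := by
    have := tpp_perm3 htpp π.symm
    simpa [Y] using this
  have hvol := hb Y hY hYtpp
  -- volumes agree: product over Fin 3 reindexed by π
  have hprodX : (X 0).card * (X 1).card * (X 2).card = ∏ j : Fin 3, (X j).card :=
    (Fin.prod_univ_three (fun j => (X j).card)).symm
  have hprodY : (Y 0).card * (Y 1).card * (Y 2).card = ∏ j : Fin 3, (Y j).card :=
    (Fin.prod_univ_three (fun j => (Y j).card)).symm
  rw [hprodX]; rw [hprodY] at hvol
  have : ∏ j : Fin 3, (Y j).card = ∏ j : Fin 3, (X j).card :=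
    Fintype.prod_equiv π.symm (fun j => (Y j).card) (fun j => (X j).card) (fun j => rfl)
  omega

/-- **Conjugation invariance of a hosted volume bound.** [folklore] -/
theorem hosted_bound_conj [DecidableEq G] {μ : Fin 3 → G} {V : ℕ}
    (hb : ∀ X : Fin 3 → Finset G, (∀ i, ∀ σ ∈ X i, σ * μ i = μ i * σ) →
      TripleProductProperty (X 0) (X 1) (X 2) → (X 0).card * (X 1).card * (X 2).card ≤ V)
    (g : G) :
    ∀ X : Fin 3 → Finset G, (∀ i, ∀ σ ∈ X i, σ * (g * μ i * g⁻¹) = (g * μ i * g⁻¹) * σ) →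
      TripleProductProperty (X 0) (X 1) (X 2) → (X 0).card * (X 1).card * (X 2).card ≤ V := by
  intro X hX htpp
  let Y : Fin 3 → Finset G := fun i => (X i).image fun σ => g⁻¹ * σ * g
  have hY : ∀ i, ∀ τ ∈ Y i, τ * μ i = μ i * τ := by
    intro i τ hτ
    obtain ⟨σ, hσ, rfl⟩ := Finset.mem_image.1 hτ
    have hc := hX i σ hσ
    -- σ (g μ g⁻¹) = (g μ g⁻¹) σ  ⇒  (g⁻¹ σ g) μ = μ (g⁻¹ σ g)
    calc g⁻¹ * σ * g * μ i = g⁻¹ * (σ * (g * μ i * g⁻¹)) * g := by group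
      _ = g⁻¹ * ((g * μ i * g⁻¹) * σ) * g := by rw [hc]
      _ = μ i * (g⁻¹ * σ * g) := by group
  have hinj : Function.Injective fun σ : G => g⁻¹ * σ * g := by
    intro a b hab; simpa using hab
  have hcard : ∀ i, (Y i).card = (X i).card := fun i => Finset.card_image_of_injective _ hinj
  have hYtpp : TripleProductProperty (Y 0) (Y 1) (Y 2) := by
    intro s hs s' hs' t ht t' ht' u hu u' hu' heq
    simp only [Y, Finset.mem_image] at hs hs' ht ht' hu hu'
    obtain ⟨s, hs, rfl⟩ := hs; obtain ⟨s', hs', rfl⟩ := hs'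
    obtain ⟨t, ht, rfl⟩ := ht; obtain ⟨t', ht', rfl⟩ := ht'
    obtain ⟨u, hu, rfl⟩ := hu; obtain ⟨u', hu', rfl⟩ := hu'
    have heq' : s * s'⁻¹ * (t * t'⁻¹) * (u * u'⁻¹) = 1 := by
      have : g⁻¹ * (s * s'⁻¹ * (t * t'⁻¹) * (u * u'⁻¹)) * g = 1 := by
        rw [← heq]; group
      calc s * s'⁻¹ * (t * t'⁻¹) * (u * u'⁻¹) = g * (g⁻¹ * (s * s'⁻¹ * (t * t'⁻¹) * (u * u'⁻¹)) * g) * g⁻¹ := by group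
        _ = 1 := by rw [this]; group
    obtain ⟨r1, r2, r3⟩ := htpp s hs s' hs' t ht t' ht' u hu u' hu' heq'
    exact ⟨by rw [r1], by rw [r2], by rw [r3]⟩
  have := hb Y hY hYtpp
  simpa only [hcard] using this

end symm

end Summit.MatrixMultiplication.MatrixMultiplication.Theorems.HyperoctahedralThreshold.Negative
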